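import Summits.BirchSwinnertonDyer.Rank1Residual.X1.LayerClassesToSelmerInfty
import HarnessLib

/-!
# Route M's generator COUNT at LAYER `n`, VI: the count of classes over `K_n` with the local
# condition at the place above `p` imposed over `K_∞` (cell `b2b-bsdres`, unit
# `b2b-bsdres-eisenstein-p1`, gen 19; X1R0-GAPMAP §28, memo `V76-LOCAL-TERM-PLAN.md` §4.5 route R1′,
# step (P3))

HONEST FRAMING (run/shared/lean/b2b/bsd-rank1-residual/, verbatim in every file): the goal of the
cell is to DELETE the COMBINATION-SHAPED residual classes of the Birch–Swinnerton-Dyer formula for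
ALL analytic-rank `≤ 1` elliptic curves over `ℚ` — "full BSD formula for every rank `≤ 1` curve in
class `C`" assembled STRICTLY from published theorems — so that the rank-`≤ 1` remainder becomes
exactly the CONSTRUCTION-SHAPED classes, which are TYPED (missing-input `Prop`s), NOT attempted.
This is not "finishing BSD". Sub-cell `b2b-bsdres-eisenstein-p1` (CLASS-OWNERS row "X1 (r = 0)"):
research route; NO CLAIM BEYOND STATED CLASSES; nothing here changes a label; nothing is booked.
THEOREMS ONLY — no definition, no named fact, no typed input introduced; nothing about any
particular curve asserted.

## What and why

The counting half of route R1′ (see `X1/LayerClassesToSelmerInfty.lean` for the transport half):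
for an elliptic curve `E/K`, a `ℤ_p`-extension `κ`, the layer `K_n` with restricted tower `κ_n`, a
dual datum `D` of `Sel_{p^∞}(E/K_∞)` (`X = D.X` finitely generated), a finite place `v₀` of `K`:

* `card_le_natCard_quotient_layerIdeal_mul_natCard_ker`: a finite family of distinct `p`-torsion
  level-`0` classes `z` over `K_n` whose transports `kerH1Iso (h'_0 z)` lie in `Sel_{p^∞}(E/K_∞)`
  (membership SUPPLIED) has **`≤ #(X/I_nX) · #ker h'_0`** members, `I_n = (p, (1+T)^{pⁿ} − 1)`
  (FILE 8's proof: fibres in `ker h'_0`, images `p`-torsion and `γ^{pⁿ}`-fixed, FILE 4's pairing).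
* `natCard_le_natCard_quotient_layerIdeal_mul_sq_of_local`: for a finite `S ≤ H¹(K_n, E[p])` whose
  classes are Kummer at the finite places off `T` not above `v₀` and at `∞`, satisfy the
  `K_{n,∞}`-condition on `T`, and whose transports satisfy the `K_∞`-condition at `v₀` for all
  `Γ_K`-conjugates: **`#S ≤ #(X/I_nX) · (#E[p^∞]^{Γ_{K_n}})²`** (lossy, ANY `E(K)[p]`; gen 16's fibre
  count for `Ψ` and Greenberg's Lemma 3.1 `#ker h'_0 = #E[p^∞]^{Γ_{K_n}}`).
* `natCard_le_natCard_quotient_layerIdeal_of_local`: **`#S ≤ #(X/I_nX)`** when `E(K)[p] = 0`.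

These are FILE 9 §2–§3's counts with the `K_{n,∞}`-local hypothesis `hloc` at the prime above `p`
REPLACED by the `K_∞`-level condition at `v₀` (memo §4.5: "(M1-a) disappears"). Over `ℚ`, `κ`
cyclotomic, `v₀ = p`: the conjugates are free (FILE 22 `X1/LocalKerOverAtPConj`) and the condition is
the socket FILE 21 (`X1/StrictAtPOfInertiaTransported`) — assembled in the sequel. Nothing is booked
by this file.

References: [GreenbergLNM1716] §1 p. 60, §3 pp. 85–86 (Lemma 3.1), §4 Lemma 4.3, §5 pp. 114–118;
[SerreGaloisCohomology1997] I.§2.4; X1R0-GAPMAP §26–§28.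
-/

noncomputable section

open scoped Classical

open Function Field NumberField IsDedekindDomain WeierstrassCurve PowerSeries
  Literature.NumberTheory.EllipticCurves Literature.NumberTheory.GaloisRepresentations
  Literature.NumberTheory.GaloisCohomology
  Literature.NumberTheory.EllipticCurves.IwasawaAlgebra IsLocalRing
  Summit.BirchSwinnertonDyer.Rank1Residual.Additive
  Summit.BirchSwinnertonDyer.Rank1Residual.Additive.ZpTower
  Summit.BirchSwinnertonDyer.Rank1Residual.X1.GeneratorCountLayer
  Summit.BirchSwinnertonDyer.Rank1Residual.X1.GeneratorBoundMuLayer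
  Summit.BirchSwinnertonDyer.Rank1Residual.X1.LayerClassesToSelmerInfty

set_option autoImplicit false

namespace Summit.BirchSwinnertonDyer.Rank1Residual.X1.GeneratorCountLayerLocal

section Count

-- `K : Type` (universe 0), as FILE 6 (n1011's level-0 socket is universe 0).
variable {K : Type} [Field K] [NumberField K] {p : ℕ} [hp : Fact p.Prime]
variable {W : WeierstrassCurve K} {κ : ZpExtension K p} (n : ℕ) (κn : ZpExtension (κ.layer n) p)
  (hκn : ∀ σ : Field.absoluteGaloisGroup (κ.layer n),
    (κn σ).toAdd * (p : ℤ_[p]) ^ n = (κ (resGal (K := K) (κ.layer n) σ)).toAdd)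
  {γ : Field.absoluteGaloisGroup K} (D : W.SelmerDualData κ γ)

include hκn

/-- **`#t ≤ #(X/I_nX) · #ker h'_0`** for a finite family `t` of distinct `p`-torsion level-`0`
classes `z` over `K_n` whose transports `kerH1Iso (h'_0 z)` lie in `Sel_{p^∞}(E/K_∞)` (membership
SUPPLIED), for any dual datum `D` of `Sel_{p^∞}(E/K_∞)` over `(κ, γ)` with `X = D.X` finitely
generated and `ker h'_0` finite: FILE 8's proof — the fibres of `kerH1Iso ∘ h'_0` embed in `ker h'_0`,
the images are `p`-torsion and fixed by `γ^{pⁿ}` (FILE 6 `conjH1_kerH1Iso_layerToInfty_eq`), FILE 4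
counts them. [cite: GreenbergLNM1716, §1 p. 60, §3 pp. 85–86] -/
theorem card_le_natCard_quotient_layerIdeal_mul_natCard_ker [W.IsElliptic]
    [Module.Finite (IwasawaAlgebra p) D.X]
    [Finite ((W.baseChange (κ.layer n)).layerToInfty κn 0).ker]
    (t : Finset {z : (W.baseChange (κ.layer n)).subgroupH1 p (κn.layerSubgroup 0) // p • z = 0 ∧
      kerH1Iso W κ n κn hκn ((W.baseChange (κ.layer n)).layerToInfty κn 0 z) ∈ W.selmerInfty κ}) :
    t.card ≤ Nat.card (D.X ⧸ Ideal.span {(C (p : ℤ_[p]) : IwasawaAlgebra p),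
        (1 + (X : IwasawaAlgebra p)) ^ p ^ n - 1} • (⊤ : Submodule (IwasawaAlgebra p) D.X)) *
      Nat.card ((W.baseChange (κ.layer n)).layerToInfty κn 0).ker := by
  let g : {z : (W.baseChange (κ.layer n)).subgroupH1 p (κn.layerSubgroup 0) // p • z = 0 ∧
      kerH1Iso W κ n κn hκn ((W.baseChange (κ.layer n)).layerToInfty κn 0 z) ∈ W.selmerInfty κ} →
      W.selmerInfty κ := fun z ↦
    ⟨kerH1Iso W κ n κn hκn ((W.baseChange (κ.layer n)).layerToInfty κn 0 z.1), z.2.2⟩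
  have hg_coe : ∀ z, ((g z : W.selmerInfty κ) : W.subgroupH1 p κ.kerSubgroup) =
      kerH1Iso W κ n κn hκn ((W.baseChange (κ.layer n)).layerToInfty κn 0 z.1) := fun _ ↦ rfl
  -- fibres of `g` embed in `ker h'_0`
  have hg : ∀ z z' : {z : (W.baseChange (κ.layer n)).subgroupH1 p (κn.layerSubgroup 0) //
      p • z = 0 ∧ kerH1Iso W κ n κn hκn ((W.baseChange (κ.layer n)).layerToInfty κn 0 z) ∈
        W.selmerInfty κ}, g z = g z' →
      (z.1 - z'.1) ∈ ((W.baseChange (κ.layer n)).layerToInfty κn 0).ker := by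
    intro z z' h
    have h' := congrArg (fun s : W.selmerInfty κ ↦ (s : W.subgroupH1 p κ.kerSubgroup)) h
    simp only [hg_coe] at h'
    rw [AddMonoidHom.mem_ker, map_sub, (kerH1Iso W κ n κn hκn).injective h', sub_self]
  have hfib : ∀ b ∈ t.image g, (t.filter fun z ↦ g z = b).card ≤
      Nat.card ((W.baseChange (κ.layer n)).layerToInfty κn 0).ker := by
    intro b hb
    obtain ⟨z₀, -, rfl⟩ := Finset.mem_image.mp hb
    rw [← Nat.card_eq_finsetCard]
    refine Nat.card_le_card_of_injective
      (fun z : ↥(t.filter fun z ↦ g z = g z₀) ↦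
        (⟨z.1.1 - z₀.1, hg z.1 z₀ (Finset.mem_filter.mp z.2).2⟩ :
          ((W.baseChange (κ.layer n)).layerToInfty κn 0).ker)) fun z z' h ↦ ?_
    have h1 : z.1.1 - z₀.1 = z'.1.1 - z₀.1 := congrArg Subtype.val h
    exact Subtype.ext (Subtype.ext (sub_left_injective h1))
  -- the images are `p`-torsion and `γ^{pⁿ}`-fixed
  have himg : ∀ s ∈ t.image g, p • s = 0 ∧
      W.conjH1 p κ.kerSubgroup (γ ^ p ^ n) (s : W.subgroupH1 p κ.kerSubgroup) = s := by
    intro s hs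
    obtain ⟨z, -, rfl⟩ := Finset.mem_image.mp hs
    refine ⟨?_, ?_⟩
    · apply Subtype.ext
      change p • kerH1Iso W κ n κn hκn ((W.baseChange (κ.layer n)).layerToInfty κn 0 z.1) = 0
      rw [← map_nsmul, ← map_nsmul, z.2.1, map_zero, map_zero]
    · exact GeneratorCountLayerTransport.conjH1_kerH1Iso_layerToInfty_eq W κ n κn hκn _
        (pow_mem_layerSubgroup κ γ n)
  calc t.card ≤ Nat.card ((W.baseChange (κ.layer n)).layerToInfty κn 0).ker * (t.image g).card :=
        Finset.card_le_mul_card_image _ _ hfib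
    _ ≤ Nat.card ((W.baseChange (κ.layer n)).layerToInfty κn 0).ker *
          Nat.card (D.X ⧸ Ideal.span {(C (p : ℤ_[p]) : IwasawaAlgebra p),
            (1 + (X : IwasawaAlgebra p)) ^ p ^ n - 1} •
              (⊤ : Submodule (IwasawaAlgebra p) D.X)) :=
        Nat.mul_le_mul_left _ (card_le_natCard_quotient_layerIdeal D n _ himg)
    _ = _ := mul_comm _ _

/-- **THE LOSSY COUNT IN THE `K`-FRAMEWORK AT `v₀`.** `E/K` elliptic, `κ` a `ℤ_p`-extension,
`K_n` with restricted tower `κ_n`, `E(K_{n,∞})[p^∞]` finite, `D` any dual datum of `Sel_{p^∞}(E/K_∞)`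
(`X = D.X` f.g.), `v₀` a finite place of `K`, and `S ≤ H¹(K_n, E[p])` a finite subgroup whose classes
are Kummer at the finite places off `T` not above `v₀` and at `∞`, satisfy the `K_{n,∞}`-condition on
`T`, and whose transports `conj_σ (kerH1Iso (h'_0 (Ψ y)))` satisfy the `K_∞`-condition at `v₀` for
every `σ ∈ Γ_K`. Then **`#S ≤ #(X/I_nX) · (#E[p^∞]^{Γ_{K_n}})²`**, `I_n = (p, (1+T)^{pⁿ} − 1)`: gen 16's
fibre count for `Ψ` (`#ker Ψ ≤ #E[p^∞]^{Γ_{K_n}}`) into the family of the previous theorem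
(`#ker h'_0 = #E[p^∞]^{Γ_{K_n}}`, Greenberg Lemma 3.1).
[cite: GreenbergLNM1716, §3 Lemma 3.1 (p. 86), §5 p. 114] -/
theorem natCard_le_natCard_quotient_layerIdeal_mul_sq_of_local [W.IsElliptic]
    [Module.Finite (IwasawaAlgebra p) D.X]
    [Finite (FixedPoints.addSubgroup κn.kerSubgroup
      (geomPrimaryTorsion (W.baseChange (κ.layer n)) p))]
    (S : AddSubgroup (galH1Torsion (W.baseChange (κ.layer n)) (p : ℤ))) [Finite S]
    (v₀ : HeightOneSpectrum (𝓞 K)) (T : Set (HeightOneSpectrum (𝓞 (κ.layer n))))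
    (hfin : ∀ y ∈ S, ∀ w : HeightOneSpectrum (𝓞 (κ.layer n)), w ∉ T →
      ¬ w.asIdeal.LiesOver v₀.asIdeal →
      y ∈ selmerLocalKer (W.baseChange (κ.layer n)) (w.adicCompletion (κ.layer n)) (p : ℤ))
    (hinf : ∀ y ∈ S, ∀ w : InfinitePlace (κ.layer n),
      y ∈ selmerLocalKer (W.baseChange (κ.layer n)) w.Completion (p : ℤ))
    (hT : ∀ y ∈ S, ∀ w ∈ T, (W.baseChange (κ.layer n)).layerToInfty κn 0
        (resH1Hom (Literature.NumberTheory.EllipticCurves.subgroupIncl (κn.layerSubgroup 0))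
          (AddMonoidHom.id (geomPrimaryTorsion (W.baseChange (κ.layer n)) p)) (fun _ _ ↦ rfl)
          (torsionToPrimaryH1 (W.baseChange (κ.layer n)) p y)) ∈
        (W.baseChange (κ.layer n)).localKerOver p κn.kerSubgroup (w.adicCompletion (κ.layer n)))
    (hv₀ : ∀ y ∈ S, ∀ σ : Field.absoluteGaloisGroup K, W.conjH1 p κ.kerSubgroup σ
        (kerH1Iso W κ n κn hκn ((W.baseChange (κ.layer n)).layerToInfty κn 0
          (resH1Hom (Literature.NumberTheory.EllipticCurves.subgroupIncl (κn.layerSubgroup 0))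
            (AddMonoidHom.id (geomPrimaryTorsion (W.baseChange (κ.layer n)) p)) (fun _ _ ↦ rfl)
            (torsionToPrimaryH1 (W.baseChange (κ.layer n)) p y)))) ∈
      W.localKerOver p κ.kerSubgroup (v₀.adicCompletion K)) :
    Nat.card S ≤ Nat.card (D.X ⧸ Ideal.span {(C (p : ℤ_[p]) : IwasawaAlgebra p),
        (1 + (X : IwasawaAlgebra p)) ^ p ^ n - 1} • (⊤ : Submodule (IwasawaAlgebra p) D.X)) *
      Nat.card {a : geomPrimaryTorsion (W.baseChange (κ.layer n)) p //
        ∀ σ : Field.absoluteGaloisGroup (κ.layer n), σ • a = a} ^ 2 := by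
  haveI : NumberField (κ.layer n) := numberField_layer κ n
  haveI : Fintype S := Fintype.ofFinite S
  haveI := GeneratorCountTorsion.finite_ker_layerToInfty_zero (W.baseChange (κ.layer n)) κn
  have hBfin := GeneratorCountTorsion.finite_fixedPoints_of_finite_fixedPoints_kerSubgroup (W.baseChange (κ.layer n)) κn
    (p := p)
  haveI hkfin : Finite (torsionToPrimaryH1 (W.baseChange (κ.layer n)) p).ker :=
    GeneratorCountTorsion.finite_ker_torsionToPrimaryH1 (W.baseChange (κ.layer n)) p hBfin
  have hker := GeneratorCountTorsion.natCard_ker_torsionToPrimaryH1_le (W.baseChange (κ.layer n)) p hBfin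
  -- the map `S → {level-0 classes with transport in Sel_∞}`
  let f : S → {z : (W.baseChange (κ.layer n)).subgroupH1 p (κn.layerSubgroup 0) // p • z = 0 ∧
      kerH1Iso W κ n κn hκn ((W.baseChange (κ.layer n)).layerToInfty κn 0 z) ∈ W.selmerInfty κ} := fun y ↦
    ⟨resH1Hom (Literature.NumberTheory.EllipticCurves.subgroupIncl (κn.layerSubgroup 0))
        (AddMonoidHom.id (geomPrimaryTorsion (W.baseChange (κ.layer n)) p)) (fun _ _ ↦ rfl) (torsionToPrimaryH1 (W.baseChange (κ.layer n)) p y),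
      Additive.smul_resH1Hom_torsionToPrimaryH1_eq_zero (W.baseChange (κ.layer n)) p κn y,
      kerH1Iso_layerToInfty_mem_selmerInfty_of_local W κ n κn hκn _ v₀
        (fun w hw ↦ by
          by_cases hwT : w ∈ T
          · exact hT y y.2 w hwT
          · exact Additive.layerToInfty_zero_mem_localKerOver_of_mem (W.baseChange (κ.layer n)) p κn
              (Additive.resH1Hom_mem_localKerOver_layerZero_of_mem_selmerLocalKerPrimary (W.baseChange (κ.layer n)) p κn
                ((Additive.torsionToPrimaryH1_mem_selmerLocalKerPrimary_iff (W.baseChange (κ.layer n)) p y).mpr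
                  (hfin y y.2 w hwT hw))))
        (fun w ↦ Additive.layerToInfty_zero_mem_localKerOver_of_mem (W.baseChange (κ.layer n)) p κn
          (Additive.resH1Hom_mem_localKerOver_layerZero_of_mem_selmerLocalKerPrimary (W.baseChange (κ.layer n)) p κn
            ((Additive.torsionToPrimaryH1_mem_selmerLocalKerPrimary_iff (W.baseChange (κ.layer n)) p y).mpr (hinf y y.2 w))))
        (hv₀ y y.2)⟩
  have hf : ∀ y₁ y₂ : S, f y₁ = f y₂ →
      ((y₁ : galH1Torsion (W.baseChange (κ.layer n)) (p : ℤ)) - y₂) ∈ (torsionToPrimaryH1 (W.baseChange (κ.layer n)) p).ker := by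
    intro y₁ y₂ h
    have h' := congrArg (fun z : {z : (W.baseChange (κ.layer n)).subgroupH1 p (κn.layerSubgroup 0) // p • z = 0 ∧
      kerH1Iso W κ n κn hκn ((W.baseChange (κ.layer n)).layerToInfty κn 0 z) ∈ W.selmerInfty κ} ↦ z.1) h
    have h'' : torsionToPrimaryH1 (W.baseChange (κ.layer n)) p y₁ = torsionToPrimaryH1 (W.baseChange (κ.layer n)) p y₂ :=
      Additive.resH1Hom_layerSubgroup_zero_injective (W.baseChange (κ.layer n)) p κn h'
    rw [AddMonoidHom.mem_ker, map_sub, h'', sub_self]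
  -- fibres of `f` embed in `ker Ψ`
  have hfib : ∀ b ∈ Finset.univ.image f,
      (Finset.univ.filter fun y : S ↦ f y = b).card ≤ Nat.card (torsionToPrimaryH1 (W.baseChange (κ.layer n)) p).ker := by
    intro b hb
    obtain ⟨y₀, -, rfl⟩ := Finset.mem_image.mp hb
    rw [← Nat.card_eq_finsetCard]
    refine Nat.card_le_card_of_injective
      (fun y : ↥(Finset.univ.filter fun y : S ↦ f y = f y₀) ↦
        (⟨(y.1 : galH1Torsion (W.baseChange (κ.layer n)) (p : ℤ)) - y₀, hf y.1 y₀ (Finset.mem_filter.mp y.2).2⟩ :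
          (torsionToPrimaryH1 (W.baseChange (κ.layer n)) p).ker)) fun y y' h ↦ ?_
    have h1 : ((y.1 : galH1Torsion (W.baseChange (κ.layer n)) (p : ℤ)) - y₀) = (y'.1 : galH1Torsion (W.baseChange (κ.layer n)) (p : ℤ)) - y₀ :=
      congrArg Subtype.val h
    exact Subtype.ext (Subtype.ext (sub_left_injective h1))
  have ht := card_le_natCard_quotient_layerIdeal_mul_natCard_ker n κn hκn D (Finset.univ.image f)
  rw [GeneratorCountTorsion.natCard_ker_layerToInfty_zero_eq (W.baseChange (κ.layer n)) κn] at ht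
  calc Nat.card S = (Finset.univ : Finset S).card := by
        rw [Nat.card_eq_fintype_card, Finset.card_univ]
    _ ≤ Nat.card (torsionToPrimaryH1 (W.baseChange (κ.layer n)) p).ker * (Finset.univ.image f).card :=
        Finset.card_le_mul_card_image _ _ hfib
    _ ≤ Nat.card {a : geomPrimaryTorsion (W.baseChange (κ.layer n)) p //
          ∀ σ : Field.absoluteGaloisGroup (κ.layer n), σ • a = a} *
          (Nat.card (D.X ⧸ Ideal.span {(C (p : ℤ_[p]) : IwasawaAlgebra p),
            (1 + (X : IwasawaAlgebra p)) ^ p ^ n - 1} • (⊤ : Submodule (IwasawaAlgebra p) D.X)) *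
          Nat.card {a : geomPrimaryTorsion (W.baseChange (κ.layer n)) p //
            ∀ σ : Field.absoluteGaloisGroup (κ.layer n), σ • a = a}) :=
        Nat.mul_le_mul hker ht
    _ = _ := by ring

/-- **THE COUNT IN THE `K`-FRAMEWORK AT `v₀` WHEN `E(K)[p] = 0`** (then `E(K_n)[p] = 0`, n1011's
`forall_smul_eq_zero_baseChange_layer`, and `Ψ`, `h'_0`, `kerH1Iso` are injective): under the local
hypotheses of the previous theorem, **`#S ≤ #(X/I_nX)`**. [cite: GreenbergLNM1716, §1 p. 60, §3 pp. 85–86] -/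
theorem natCard_le_natCard_quotient_layerIdeal_of_local [W.IsElliptic]
    [Module.Finite (IwasawaAlgebra p) D.X] (hK : ∀ P : W.toAffine.Point, p • P = 0 → P = 0)
    (S : AddSubgroup (galH1Torsion (W.baseChange (κ.layer n)) (p : ℤ))) [Finite S]
    (v₀ : HeightOneSpectrum (𝓞 K)) (T : Set (HeightOneSpectrum (𝓞 (κ.layer n))))
    (hfin : ∀ y ∈ S, ∀ w : HeightOneSpectrum (𝓞 (κ.layer n)), w ∉ T →
      ¬ w.asIdeal.LiesOver v₀.asIdeal →
      y ∈ selmerLocalKer (W.baseChange (κ.layer n)) (w.adicCompletion (κ.layer n)) (p : ℤ))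
    (hinf : ∀ y ∈ S, ∀ w : InfinitePlace (κ.layer n),
      y ∈ selmerLocalKer (W.baseChange (κ.layer n)) w.Completion (p : ℤ))
    (hT : ∀ y ∈ S, ∀ w ∈ T, (W.baseChange (κ.layer n)).layerToInfty κn 0
        (resH1Hom (Literature.NumberTheory.EllipticCurves.subgroupIncl (κn.layerSubgroup 0))
          (AddMonoidHom.id (geomPrimaryTorsion (W.baseChange (κ.layer n)) p)) (fun _ _ ↦ rfl)
          (torsionToPrimaryH1 (W.baseChange (κ.layer n)) p y)) ∈
        (W.baseChange (κ.layer n)).localKerOver p κn.kerSubgroup (w.adicCompletion (κ.layer n)))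
    (hv₀ : ∀ y ∈ S, ∀ σ : Field.absoluteGaloisGroup K, W.conjH1 p κ.kerSubgroup σ
        (kerH1Iso W κ n κn hκn ((W.baseChange (κ.layer n)).layerToInfty κn 0
          (resH1Hom (Literature.NumberTheory.EllipticCurves.subgroupIncl (κn.layerSubgroup 0))
            (AddMonoidHom.id (geomPrimaryTorsion (W.baseChange (κ.layer n)) p)) (fun _ _ ↦ rfl)
            (torsionToPrimaryH1 (W.baseChange (κ.layer n)) p y)))) ∈
      W.localKerOver p κ.kerSubgroup (v₀.adicCompletion K)) :
    Nat.card S ≤ Nat.card (D.X ⧸ Ideal.span {(C (p : ℤ_[p]) : IwasawaAlgebra p),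
        (1 + (X : IwasawaAlgebra p)) ^ p ^ n - 1} • (⊤ : Submodule (IwasawaAlgebra p) D.X)) := by
  haveI : NumberField (κ.layer n) := numberField_layer κ n
  have hKn : ∀ Q : (W.baseChange (κ.layer n)).toAffine.Point, p • Q = 0 → Q = 0 :=
    forall_smul_eq_zero_baseChange_layer W p κ hK n
  haveI : Fintype S := Fintype.ofFinite S
  let f : S → W.selmerInfty κ := fun y ↦
    ⟨kerH1Iso W κ n κn hκn ((W.baseChange (κ.layer n)).layerToInfty κn 0
        (resH1Hom (Literature.NumberTheory.EllipticCurves.subgroupIncl (κn.layerSubgroup 0))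
          (AddMonoidHom.id (geomPrimaryTorsion (W.baseChange (κ.layer n)) p)) (fun _ _ ↦ rfl) (torsionToPrimaryH1 (W.baseChange (κ.layer n)) p y))),
      kerH1Iso_layerToInfty_mem_selmerInfty_of_local W κ n κn hκn _ v₀
        (fun w hw ↦ by
          by_cases hwT : w ∈ T
          · exact hT y y.2 w hwT
          · exact Additive.layerToInfty_zero_mem_localKerOver_of_mem (W.baseChange (κ.layer n)) p κn
              (Additive.resH1Hom_mem_localKerOver_layerZero_of_mem_selmerLocalKerPrimary (W.baseChange (κ.layer n)) p κn
                ((Additive.torsionToPrimaryH1_mem_selmerLocalKerPrimary_iff (W.baseChange (κ.layer n)) p y).mpr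
                  (hfin y y.2 w hwT hw))))
        (fun w ↦ Additive.layerToInfty_zero_mem_localKerOver_of_mem (W.baseChange (κ.layer n)) p κn
          (Additive.resH1Hom_mem_localKerOver_layerZero_of_mem_selmerLocalKerPrimary (W.baseChange (κ.layer n)) p κn
            ((Additive.torsionToPrimaryH1_mem_selmerLocalKerPrimary_iff (W.baseChange (κ.layer n)) p y).mpr (hinf y y.2 w))))
        (hv₀ y y.2)⟩
  have hf : Function.Injective f := by
    intro y₁ y₂ h
    have h' := congrArg (fun s : W.selmerInfty κ ↦ (s : W.subgroupH1 p κ.kerSubgroup)) h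
    have h'' := Additive.layerToInfty_injective_of_no_pTorsion (W.baseChange (κ.layer n)) κn
      (fun Q hQ ↦ hKn Q (by convert hQ)) 0 ((kerH1Iso W κ n κn hκn).injective h')
    exact Subtype.ext (Additive.resH1Hom_torsionToPrimaryH1_injective_of_no_pTorsion (W.baseChange (κ.layer n)) p κn
      (fun Q hQ ↦ hKn Q (by convert hQ)) h'')
  have himg : ∀ s ∈ Finset.univ.image f, p • s = 0 ∧
      W.conjH1 p κ.kerSubgroup (γ ^ p ^ n) (s : W.subgroupH1 p κ.kerSubgroup) = s := by
    intro s hs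
    obtain ⟨y, -, rfl⟩ := Finset.mem_image.mp hs
    refine ⟨?_, ?_⟩
    · apply Subtype.ext
      change p • kerH1Iso W κ n κn hκn ((W.baseChange (κ.layer n)).layerToInfty κn 0 _) = 0
      rw [← map_nsmul, ← map_nsmul, Additive.smul_resH1Hom_torsionToPrimaryH1_eq_zero (W.baseChange (κ.layer n)) p κn y,
        map_zero, map_zero]
    · exact GeneratorCountLayerTransport.conjH1_kerH1Iso_layerToInfty_eq W κ n κn hκn _
        (pow_mem_layerSubgroup κ γ n)
  calc Nat.card S = (Finset.univ : Finset S).card := by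
        rw [Nat.card_eq_fintype_card, Finset.card_univ]
    _ = (Finset.univ.image f).card := (Finset.card_image_of_injective _ hf).symm
    _ ≤ _ := card_le_natCard_quotient_layerIdeal D n _ himg

end Count

end Summit.BirchSwinnertonDyer.Rank1Residual.X1.GeneratorCountLayerLocal

end
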